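import Summits.QuantumFields.YangMills.Theorems.UnitScaleTiltProp8HalvingHMatrixSup
import Summits.QuantumFields.YangMills.Theorems.UnitScaleTiltProp8HalvingSiteAssembly
import HarnessLib

/-!
# Route `UnitScaleTilt`, crux K1 child «MinimiserStabilityRegPr» (stmt-QuantumFields-19200), registered stub V2′ `stub_halvingStep`
# (skeletons v8 5b4e846794b80374 / v10 `BirthV10`) — **THE (157)-R ROW OF THE HALVING PACKAGE ON THE LAYER** (owner preference 02:31:10Z: the P5 assembler
# builds `R = HD(A′)` with P2's `flatH`): the three letters `‖R‖`, `η⁻¹‖∇R‖`, `‖∂^{η*}∂^ηR‖` of a kernel image `R(b) = Σ_c (He_c)(b)·X(c)` of a SUP-SIZED `𝔤`-valued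
# datum (`‖X(c)‖ ≤ t·L^{k−j(c)}`, e.g. `‖D(A′)(c)‖ ≤ C₂r²`) on the layer of the one-point top family at `x` — EXACTLY the `s₃`∕`g₃`∕`d₃` clauses of
# `HalvingAssemblyInterior.siteClause_of_pieces_int`∕`H_of_packageInt` with `e₃ = B₀B₃t` — from w3 g2's per-bond `HalvingHMatrixSup.matrixRowsSup` and the layer
# geometry (weights `1`, the bond one block from `Bᵏ(x)`)

Cell `ym3-torus` (HUMAN RULING D-0037, YM ladder rung R3 — continuum SU(2) YM₃ on the torus is a RUNG, not the Clay problem), width seat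
`ym-ust-19200-w3` gen 3 (D-0149).  `--supports stmt-QuantumFields-19200 --as helper`; def-free, 0 sorry, standard axioms.

THE PRINT ([Balaban1985Variational] (157) p.302, (159) p.303 `A = A₁ + HB − HD(A₁ + HB)`, (165) p.304: the `4C₂`-term is the remainder `HD(A′)` through the letters of `H`
((161)₁, (162)) and the size (55) `|D(A′)| ≤ C₂|A′|²`).

WHAT THIS FILE PROVES (no definition, no sorry): **`row157_of_kernelDatum`** (datum of weighted sup size `t·L^{k−j(c)}`) and **`row157_of_supDatum`** (datum of plain sup
size `t`): at the cube sequence `cubeSeqMT3 F n K x ρ S M` (`ρ ≥ 1`) with its level weights and P2's `H`-rows (`HDecayLetterD` over `dBI ≥ distBI`, `RowSum162`), for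
`R(b) = Σ_c (He_c)(b)·X(c)`: the three (157)-R conjuncts of the package on the layer with `e₃ = B₀B₃t`.
HONEST SCOPE.  Bookkeeping; the datum size ((55)∕P3a `ChartRemainderAt`) and the identification of the assembler's `R` with the kernel image are the consumer's; the
`flatH`-vs-`Q_lin`-inverse gauge correction (junction G3) is separate.  NOT a claim about the crux, the rung, or the mass gap.

References: T. Bałaban, CMP **102** (1985) 277–309 [Balaban1985Variational] (55) p.286, (157) p.302, (159) p.303, (161)–(163) p.303, (165) p.304.
-/

set_option autoImplicit false

noncomputable section

open scoped BigOperators Matrix.Norms.L2Operator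

namespace Summit.QuantumFields.YangMills.Theorems.HalvingRRow157

open Literature.MathematicalPhysics.QuantumFieldTheory.Balaban1983to89
open B5Eq117TorusCarriers (Mk)
open B5Eq118OneStroke (iterBlockOf)
open B5Prop12FieldsLattice (distSite distSite_nonneg)
open B6SectAOperatorsV1 (BondIdx)
open B8Ineq132 (BondTouches)
open B8Eq140Level (SideTouches)
open B8Eq143PlaqExpansion (pdiv)
open B8Eq146AExpansion (plaqCovDeriv)
open B8Thm2SetupTorus (pullDom)
open B10Eq27TorusAxialLog (pull transl)
open T3ContinuumYM3Torus (T3Family)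
open FlatCubeOpsText (IsLevWeight distBI HDecayLetterD RowSum162)
open FlatCubeSequenceAligned (cubeSeqMT3)
open HalvingQuarterCubeSeq (levWeight_eq_one_of_inOm_top inOm_top_of_dist)
open HalvingSiteAssembly (dist_le_one_of_sideTouches dist_le_one_of_bondTouches distSite_iterBlockOf_le_one_of_le_one)
open HalvingHMatrixSup (matrixRowsSup)

variable {F : T3Family} {n K : ℕ}

/-- **THE (157)-R ROW ON THE LAYER FOR A KERNEL IMAGE OF A WEIGHTED-SUP-SIZED DATUM** (`‖X(c)‖ ≤ t·L^{k−j(c)}`): the `s₃`∕`g₃`∕`d₃` clauses of the package with `e₃ = B₀B₃t`.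
[cite: Balaban1985Variational, (157) p.302, (161)-(163) p.303, (165) p.304] -/
theorem row157_of_kernelDatum (hnK : n < K) (x : Site (F.P K) 0) (ρ S M : ℕ) (hM : 1 ≤ M) (hρ1 : 1 ≤ ρ)
    {w : ℕ → PBond (F.P K) 0 → ℝ} (hw : IsLevWeight F n K (cubeSeqMT3 F n K x ρ S M hM) w)
    {H : (BondIdx (cubeSeqMT3 F n K x ρ S M hM) → ℝ) →ₗ[ℝ] (PBond (F.P K) 0 → ℝ)}
    {dBI : PBond (F.P K) 0 → BondIdx (cubeSeqMT3 F n K x ρ S M hM) → ℝ} {δ₀ B₀ B₃ t : ℝ}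
    (hH : HDecayLetterD F n K (cubeSeqMT3 F n K x ρ S M hM) dBI w H B₀ δ₀) (h162 : RowSum162 F n K (cubeSeqMT3 F n K x ρ S M hM) dBI w δ₀ B₃)
    (hdom : ∀ b c, distBI (cubeSeqMT3 F n K x ρ S M hM) b c ≤ dBI b c) (hδ₀ : 0 ≤ δ₀) (hB₀ : 0 ≤ B₀) (hB₃ : 0 ≤ B₃) (ht : 0 ≤ t)
    {X : BondIdx (cubeSeqMT3 F n K x ρ S M hM) → Matrix (Fin 2) (Fin 2) ℂ} {R : PBond (F.P K) 0 → Matrix (Fin 2) (Fin 2) ℂ}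
    (hR : ∀ b, R b = ∑ c, H (Pi.single c 1) b • X c)
    (hX : ∀ c : BondIdx (cubeSeqMT3 F n K x ρ S M hM), ‖X c‖ ≤ t * (F.L : ℝ) ^ ((K - n) - (c.1.1 : ℕ))) :
    (∀ (z : B7Prop1Explicit.Site (F.P K).d) (τ : Fin (F.P K).d),
      SideTouches (pullDom (fun j => if K - n ≤ j then ({x} : Set (Site (F.P K) 0)) else (∅ : Set (Site (F.P K) 0))) (K - n)) z τ →
      ‖R ⟨transl 0 z, τ⟩‖ ≤ B₀ * B₃ * t) ∧
    (∀ (z : B7Prop1Explicit.Site (F.P K).d) (κ τ : Fin (F.P K).d),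
      SideTouches (pullDom (fun j => if K - n ≤ j then ({x} : Set (Site (F.P K) 0)) else (∅ : Set (Site (F.P K) 0))) (K - n)) z τ →
      ‖(((F.L : ℝ)⁻¹) ^ (K - n))⁻¹ • (R ⟨(transl 0 z).shift κ, τ⟩ - R ⟨transl 0 z, τ⟩)‖ ≤ B₀ * B₃ * t) ∧
    (∀ (z : B7Prop1Explicit.Site (F.P K).d) (μ : Fin (F.P K).d),
      BondTouches (pullDom (fun j => if K - n ≤ j then ({x} : Set (Site (F.P K) 0)) else (∅ : Set (Site (F.P K) 0))) (K - n)) z μ →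
      ‖pdiv (((F.L : ℝ)⁻¹) ^ (K - n)) (1 : B7Prop1Explicit.Site (F.P K).d → Fin (F.P K).d → (Matrix (Fin 2) (Fin 2) ℂ)ˣ)
          (plaqCovDeriv (((F.L : ℝ)⁻¹) ^ (K - n)) (1 : B7Prop1Explicit.Site (F.P K).d → Fin (F.P K).d → (Matrix (Fin 2) (Fin 2) ℂ)ˣ)
            (pull R 0)) μ z‖ ≤ B₀ * B₃ * t) := by
  have hkm : K - n ≤ (F.P K).m + (F.P K).K := FlatMinimizerH.le_T3 F n K
  have hL0 : (0 : ℝ) < (F.L : ℝ) := by exact_mod_cast lt_trans zero_lt_one F.hL.2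
  have hη : ((((F.L : ℝ)⁻¹) ^ (K - n))⁻¹ : ℝ) = (F.L : ℝ) ^ (K - n) := by rw [inv_pow, inv_inv]
  have hρ1' : (1 : ℝ) ≤ (ρ : ℝ) := by exact_mod_cast hρ1
  have hd : ∀ b c, 0 ≤ dBI b c := fun b c => by
    refine le_trans ?_ (hdom b c)
    unfold distBI
    exact mul_nonneg (by positivity) (distSite_nonneg _ _)
  -- the weights are `1` at every bond whose source is one block from `Bᵏ(x)`
  have hw1 : ∀ {b : PBond (F.P K) 0}, distSite (Mk (F.P K) 0) b.src x ≤ 1 → ∀ m, w m b = 1 := by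
    intro b hb m
    have hblk := distSite_iterBlockOf_le_one_of_le_one hkm hb
    exact levWeight_eq_one_of_inOm_top rfl hw (inOm_top_of_dist hnK x ρ S M hM hblk hρ1') m
  -- the three rows at such a bond
  have rows : ∀ {b : PBond (F.P K) 0}, distSite (Mk (F.P K) 0) b.src x ≤ 1 → _ :=
    fun {b} hb => matrixRowsSup hH h162 hδ₀ hB₀ hB₃ ht (hd b) (hw1 hb) hR hX
  refine ⟨fun z τ hz => ?_, fun z κ τ hz => ?_, fun z μ hz => ?_⟩
  · exact (rows (b := ⟨transl 0 z, τ⟩) (dist_le_one_of_sideTouches x (K - n) hz)).1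
  · have h := (rows (b := ⟨transl 0 z, τ⟩) (dist_le_one_of_sideTouches x (K - n) hz)).2.1 κ
    rw [norm_smul, hη, Real.norm_of_nonneg (pow_nonneg hL0.le _)]
    exact h
  · exact (rows (b := ⟨transl 0 z, μ⟩) (dist_le_one_of_bondTouches x (K - n) hz)).2.2 z μ rfl

/-- **THE (157)-R ROW ON THE LAYER FOR A KERNEL IMAGE OF A PLAIN-SUP-SIZED DATUM** (`‖X(c)‖ ≤ t`, e.g. P3a's remainder size `‖D(A′)(c)‖ ≤ C₂r²`; `t ≤ t·L^{k−j(c)}`):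
the three (157)-R conjuncts of the package with `e₃ = B₀B₃t`. [cite: Balaban1985Variational, (55) p.286, (157) p.302, (165) p.304] -/
theorem row157_of_supDatum (hnK : n < K) (x : Site (F.P K) 0) (ρ S M : ℕ) (hM : 1 ≤ M) (hρ1 : 1 ≤ ρ)
    {w : ℕ → PBond (F.P K) 0 → ℝ} (hw : IsLevWeight F n K (cubeSeqMT3 F n K x ρ S M hM) w)
    {H : (BondIdx (cubeSeqMT3 F n K x ρ S M hM) → ℝ) →ₗ[ℝ] (PBond (F.P K) 0 → ℝ)}
    {dBI : PBond (F.P K) 0 → BondIdx (cubeSeqMT3 F n K x ρ S M hM) → ℝ} {δ₀ B₀ B₃ t : ℝ}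
    (hH : HDecayLetterD F n K (cubeSeqMT3 F n K x ρ S M hM) dBI w H B₀ δ₀) (h162 : RowSum162 F n K (cubeSeqMT3 F n K x ρ S M hM) dBI w δ₀ B₃)
    (hdom : ∀ b c, distBI (cubeSeqMT3 F n K x ρ S M hM) b c ≤ dBI b c) (hδ₀ : 0 ≤ δ₀) (hB₀ : 0 ≤ B₀) (hB₃ : 0 ≤ B₃) (ht : 0 ≤ t)
    {X : BondIdx (cubeSeqMT3 F n K x ρ S M hM) → Matrix (Fin 2) (Fin 2) ℂ} {R : PBond (F.P K) 0 → Matrix (Fin 2) (Fin 2) ℂ}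
    (hR : ∀ b, R b = ∑ c, H (Pi.single c 1) b • X c) (hX : ∀ c : BondIdx (cubeSeqMT3 F n K x ρ S M hM), ‖X c‖ ≤ t) :
    (∀ (z : B7Prop1Explicit.Site (F.P K).d) (τ : Fin (F.P K).d),
      SideTouches (pullDom (fun j => if K - n ≤ j then ({x} : Set (Site (F.P K) 0)) else (∅ : Set (Site (F.P K) 0))) (K - n)) z τ →
      ‖R ⟨transl 0 z, τ⟩‖ ≤ B₀ * B₃ * t) ∧
    (∀ (z : B7Prop1Explicit.Site (F.P K).d) (κ τ : Fin (F.P K).d),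
      SideTouches (pullDom (fun j => if K - n ≤ j then ({x} : Set (Site (F.P K) 0)) else (∅ : Set (Site (F.P K) 0))) (K - n)) z τ →
      ‖(((F.L : ℝ)⁻¹) ^ (K - n))⁻¹ • (R ⟨(transl 0 z).shift κ, τ⟩ - R ⟨transl 0 z, τ⟩)‖ ≤ B₀ * B₃ * t) ∧
    (∀ (z : B7Prop1Explicit.Site (F.P K).d) (μ : Fin (F.P K).d),
      BondTouches (pullDom (fun j => if K - n ≤ j then ({x} : Set (Site (F.P K) 0)) else (∅ : Set (Site (F.P K) 0))) (K - n)) z μ →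
      ‖pdiv (((F.L : ℝ)⁻¹) ^ (K - n)) (1 : B7Prop1Explicit.Site (F.P K).d → Fin (F.P K).d → (Matrix (Fin 2) (Fin 2) ℂ)ˣ)
          (plaqCovDeriv (((F.L : ℝ)⁻¹) ^ (K - n)) (1 : B7Prop1Explicit.Site (F.P K).d → Fin (F.P K).d → (Matrix (Fin 2) (Fin 2) ℂ)ˣ)
            (pull R 0)) μ z‖ ≤ B₀ * B₃ * t) := by
  have hL1 : (1 : ℝ) ≤ (F.L : ℝ) := by exact_mod_cast F.hL.2.le
  refine row157_of_kernelDatum hnK x ρ S M hM hρ1 hw hH h162 hdom hδ₀ hB₀ hB₃ ht hR fun c => (hX c).trans ?_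
  exact le_mul_of_one_le_right ht (one_le_pow₀ hL1)

end Summit.QuantumFields.YangMills.Theorems.HalvingRRow157

end
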